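import Summits.CriticalPhenomena.CardyFormulaZ2.Theorems.CardyUniqueLimitCardyRigidityFarFieldMoments

/-!
# Second moment of the stopped-modulus increment (line `crossing-martingale`, crux `CardyRigidity`)

Continuation of `…FarFieldMoments` (far-field MOMENT engine of stub `stub_kernelAffineCardy`,
crux `CardyRigidity`, stmt-CriticalPhenomena-0746): in the abstract setting of that file (sure bound
`|h n| ≤ C q/n`, `q = n^{3/4}`; good-event expansion `|h n - D n + S n X/n + P n X²/n²| ≤ C'(B³+B+1)/n³`
on `{B ≤ q/2}`; `S n → S₀`, `P n → P₀`, `n² D n → D₀`; `|X| ≤ B ∈ L³`):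

* `tendsto_second_moment` — `n² E[(h n)²] → S₀² E[X²]` (on the good event
  `|h² - S²X²/n²| ≤ (|D| + |P|B²/n² + |C'|(B³+B+1)/n³)(|C| q/n + |S| B/n)`, each product integrating
  to `o(n⁻²)`; the complement contributes `≤ 8 C² E[B³]/q`).
-/

noncomputable section

open MeasureTheory Filter Set Topology
open scoped NNReal ENNReal

namespace Summit.CriticalPhenomena.CardyFormulaZ2.Cruxes.CardyRigidity.CrossingMartingale

namespace FarField

section Moments

variable {Ω : Type*} {mΩ : MeasurableSpace Ω} {μ : Measure Ω} [IsProbabilityMeasure μ]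
  {X B : Ω → ℝ} {h : ℕ → Ω → ℝ} {S P D : ℕ → ℝ} {S₀ P₀ D₀ C C' : ℝ}

/-- Pathwise algebra on the good event: with `h = D - S X/n - P X²/n² + ρ`, `|ρ| ≤ R`,
`|h| ≤ hb`, `|X| ≤ B`, `0 ≤ B`, one has
`|h² - S² X²/n²| ≤ (|D| + |P| B²/n² + R)(hb + |S| B/n)`. [folklore] -/
theorem abs_sq_sub_main_le {hω Dn Sn Pn Xω Bω ρω R hb n : ℝ} (hn : 0 < n)
    (hdef : hω - Dn + Sn * (Xω / n) + Pn * (Xω / n) ^ 2 = ρω) (hρ : |ρω| ≤ R)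
    (hh : |hω| ≤ hb) (hX : |Xω| ≤ Bω) (hB : 0 ≤ Bω) :
    |hω ^ 2 - Sn ^ 2 * Xω ^ 2 / n ^ 2| ≤ (|Dn| + |Pn| * Bω ^ 2 / n ^ 2 + R) * (hb + |Sn| * Bω / n) := by
  have hfac : hω ^ 2 - Sn ^ 2 * Xω ^ 2 / n ^ 2 =
      (Dn - Pn * (Xω / n) ^ 2 + ρω) * (hω + -(Sn * (Xω / n))) := by
    rw [← hdef]; ring
  rw [hfac, abs_mul]
  have hX2 : Xω ^ 2 ≤ Bω ^ 2 := by
    have := abs_le_abs_of_nonneg (abs_nonneg Xω) hX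
    nlinarith [abs_nonneg Xω, sq_abs Xω]
  have h1 : |Dn - Pn * (Xω / n) ^ 2 + ρω| ≤ |Dn| + |Pn| * Bω ^ 2 / n ^ 2 + R := by
    have hA : |Dn - Pn * (Xω / n) ^ 2 + ρω| ≤ |Dn - Pn * (Xω / n) ^ 2| + |ρω| := abs_add_le _ _
    have hB' : |Dn - Pn * (Xω / n) ^ 2| ≤ |Dn| + |Pn * (Xω / n) ^ 2| := abs_sub _ _
    have hC : |Pn * (Xω / n) ^ 2| ≤ |Pn| * Bω ^ 2 / n ^ 2 := by
      rw [abs_mul, abs_of_nonneg (sq_nonneg (Xω / n)), div_pow, mul_div_assoc]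
      exact mul_le_mul_of_nonneg_left (div_le_div_of_nonneg_right hX2 (by positivity))
        (abs_nonneg _)
    linarith
  have h2 : |hω + -(Sn * (Xω / n))| ≤ hb + |Sn| * Bω / n := by
    calc |hω + -(Sn * (Xω / n))| ≤ |hω| + |-(Sn * (Xω / n))| := abs_add_le _ _
      _ ≤ hb + |Sn| * Bω / n := by
          rw [abs_neg, abs_mul, abs_div, abs_of_pos hn]
          have : |Sn| * (|Xω| / n) ≤ |Sn| * (Bω / n) :=
            mul_le_mul_of_nonneg_left (div_le_div_of_nonneg_right hX hn.le) (abs_nonneg _)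
          linarith [mul_div_assoc |Sn| Bω n]
  have h1nn : 0 ≤ |Dn| + |Pn| * Bω ^ 2 / n ^ 2 + R := by
    have : 0 ≤ R := (abs_nonneg _).trans hρ
    positivity
  exact mul_le_mul h1 h2 (abs_nonneg _) h1nn

/-- Elementary majorant used on the good event (`0 ≤ B ≤ q/2`, `1 ≤ n`):
the product bound of `abs_sq_sub_main_le` is at most
`|D|(|C|q + |S|B)/n + 3(|P|+|C'|)(B³+1)(|C|+|S|/2) q/n³`. [folklore] -/
theorem majorant_le {D P C' C S B q n : ℝ} (hB : 0 ≤ B) (hBq : B ≤ q / 2) (hq : 0 ≤ q)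
    (hn : 1 ≤ n) :
    (|D| + |P| * B ^ 2 / n ^ 2 + |C'| * (B ^ 3 + B + 1) / n ^ 3) * (|C| * q / n + |S| * B / n) ≤
      |D| * (|C| * q + |S| * B) / n +
        3 * (|P| + |C'|) * (B ^ 3 + 1) * (|C| + |S| / 2) * q / n ^ 3 := by
  have hn0 : 0 < n := by linarith
  have hB31 : B ≤ B ^ 3 + 1 := by nlinarith [sq_nonneg (B - 1), sq_nonneg B]
  have hB32 : B ^ 2 ≤ B ^ 3 + 1 := by nlinarith [sq_nonneg (B - 1), sq_nonneg B]
  have hn3 : n ^ 2 ≤ n ^ 3 := pow_le_pow_right₀ hn (by norm_num)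
  -- first factor ≤ |D| + 3(|P|+|C'|)(B³+1)/n²
  have hf1 : |D| + |P| * B ^ 2 / n ^ 2 + |C'| * (B ^ 3 + B + 1) / n ^ 3 ≤
      |D| + 3 * (|P| + |C'|) * (B ^ 3 + 1) / n ^ 2 := by
    have t1 : |P| * B ^ 2 / n ^ 2 ≤ |P| * (B ^ 3 + 1) / n ^ 2 := by gcongr
    have t2 : |C'| * (B ^ 3 + B + 1) / n ^ 3 ≤ |C'| * (2 * (B ^ 3 + 1)) / n ^ 2 := by
      have : |C'| * (B ^ 3 + B + 1) ≤ |C'| * (2 * (B ^ 3 + 1)) :=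
        mul_le_mul_of_nonneg_left (by linarith) (abs_nonneg _)
      calc |C'| * (B ^ 3 + B + 1) / n ^ 3 ≤ |C'| * (2 * (B ^ 3 + 1)) / n ^ 3 := by gcongr
        _ ≤ |C'| * (2 * (B ^ 3 + 1)) / n ^ 2 :=
            div_le_div_of_nonneg_left (by positivity) (by positivity) hn3
    have t3 : |P| * (B ^ 3 + 1) / n ^ 2 + |C'| * (2 * (B ^ 3 + 1)) / n ^ 2 ≤
        3 * (|P| + |C'|) * (B ^ 3 + 1) / n ^ 2 := by
      rw [← add_div, div_le_div_iff_of_pos_right (by positivity)]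
      nlinarith [abs_nonneg P, abs_nonneg C', pow_nonneg hB 3]
    linarith
  have hf2 : |C| * q / n + |S| * B / n = (|C| * q + |S| * B) / n := by ring
  rw [hf2]
  have hsec : 0 ≤ (|C| * q + |S| * B) / n := by positivity
  calc (|D| + |P| * B ^ 2 / n ^ 2 + |C'| * (B ^ 3 + B + 1) / n ^ 3) * ((|C| * q + |S| * B) / n)
      ≤ (|D| + 3 * (|P| + |C'|) * (B ^ 3 + 1) / n ^ 2) * ((|C| * q + |S| * B) / n) :=
        mul_le_mul_of_nonneg_right hf1 hsec
    _ = |D| * (|C| * q + |S| * B) / n +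
        3 * (|P| + |C'|) * (B ^ 3 + 1) * (|C| * q + |S| * B) / n ^ 3 := by
        field_simp
    _ ≤ |D| * (|C| * q + |S| * B) / n +
        3 * (|P| + |C'|) * (B ^ 3 + 1) * (|C| + |S| / 2) * q / n ^ 3 := by
        have hlast : |C| * q + |S| * B ≤ (|C| + |S| / 2) * q := by
          nlinarith [abs_nonneg C, abs_nonneg S]
        have h0 : 0 ≤ 3 * (|P| + |C'|) * (B ^ 3 + 1) := by positivity
        have : 3 * (|P| + |C'|) * (B ^ 3 + 1) * (|C| * q + |S| * B) / n ^ 3 ≤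
            3 * (|P| + |C'|) * (B ^ 3 + 1) * (|C| + |S| / 2) * q / n ^ 3 := by
          rw [div_le_div_iff_of_pos_right (by positivity)]
          calc 3 * (|P| + |C'|) * (B ^ 3 + 1) * (|C| * q + |S| * B)
              ≤ 3 * (|P| + |C'|) * (B ^ 3 + 1) * ((|C| + |S| / 2) * q) :=
                mul_le_mul_of_nonneg_left hlast h0
            _ = 3 * (|P| + |C'|) * (B ^ 3 + 1) * (|C| + |S| / 2) * q := by ring
        linarith

set_option maxHeartbeats 800000 in
-- the second-moment estimate carries a large context (three integrals, five eventual hypotheses)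
/-- **Second moment.**  `n² E[(h n)²] → S₀² E[X²]`. [folklore] -/
theorem tendsto_second_moment (hXm : Measurable X) (hBm : StronglyMeasurable B)
    (hB3 : MemLp B 3 μ) (hB0 : ∀ ω, 0 ≤ B ω) (hXB : ∀ᵐ ω ∂μ, |X ω| ≤ B ω)
    (hhm : ∀ᶠ n : ℕ in atTop, Measurable (h n))
    (hsure : ∀ᶠ n : ℕ in atTop, ∀ ω, |h n ω| ≤ C * ((n : ℝ)) ^ (3 / 4 : ℝ) / n)
    (hgood : ∀ᶠ n : ℕ in atTop, ∀ᵐ ω ∂μ, B ω ≤ ((n : ℝ)) ^ (3 / 4 : ℝ) / 2 →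
      |h n ω - D n + S n * (X ω / n) + P n * (X ω / n) ^ 2| ≤
        C' * (B ω ^ 3 + B ω + 1) / (n : ℝ) ^ 3)
    (hS : Tendsto S atTop (𝓝 S₀)) (hP : Tendsto P atTop (𝓝 P₀))
    (hD : Tendsto (fun n : ℕ ↦ (n : ℝ) ^ 2 * D n) atTop (𝓝 D₀)) :
    Tendsto (fun n : ℕ ↦ (n : ℝ) ^ 2 * ∫ ω, (h n ω) ^ 2 ∂μ) atTop (𝓝 (S₀ ^ 2 * ∫ ω, X ω ^ 2 ∂μ)) := by
  -- notation
  set q : ℕ → ℝ := fun n ↦ ((n : ℝ)) ^ (3 / 4 : ℝ) with hq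
  set G : ℕ → Set Ω := fun n ↦ {ω | B ω ≤ q n / 2} with hG
  have hGm : ∀ n, MeasurableSet (G n) := fun n ↦ measurableSet_good hBm _
  -- integrability
  have hIX2 : Integrable (fun ω ↦ X ω ^ 2) μ := by
    refine Integrable.mono' (integrable_sq_of_memLp_three hB3 hB0)
      (hXm.pow_const 2).aestronglyMeasurable ?_
    filter_upwards [hXB] with ω hω
    rw [Real.norm_eq_abs, abs_pow, sq_abs]
    have := hB0 ω
    rw [abs_le] at hω
    nlinarith
  have hIB := integrable_of_memLp_three hB3
  have hIB3 := integrable_cube_of_memLp_three hB3 hB0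
  set EB : ℝ := ∫ ω, B ω ∂μ with hEB
  set EB3 : ℝ := ∫ ω, B ω ^ 3 ∂μ with hEB3
  have hEBnn : 0 ≤ EB := integral_nonneg hB0
  have hEB3nn : 0 ≤ EB3 := integral_nonneg fun ω ↦ pow_nonneg (hB0 ω) 3
  have hIB31 : Integrable (fun ω ↦ B ω ^ 3 + 1) μ := hIB3.add (integrable_const _)
  -- the three terms
  set V₁ : ℕ → ℝ := fun n ↦ S n ^ 2 * ∫ ω in G n, X ω ^ 2 ∂μ with hV₁
  set V₂ : ℕ → ℝ := fun n ↦ (n : ℝ) ^ 2 * ∫ ω in G n, ((h n ω) ^ 2 - S n ^ 2 * X ω ^ 2 / (n : ℝ) ^ 2) ∂μ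
    with hV₂
  set V₃ : ℕ → ℝ := fun n ↦ (n : ℝ) ^ 2 * ∫ ω in (G n)ᶜ, (h n ω) ^ 2 ∂μ with hV₃
  have hdecomp : ∀ᶠ n : ℕ in atTop, (n : ℝ) ^ 2 * ∫ ω, (h n ω) ^ 2 ∂μ = V₁ n + V₂ n + V₃ n := by
    filter_upwards [hhm, hsure, eventually_gt_atTop 0] with n hmn hsn hn0
    have hnpos : (0 : ℝ) < n := by exact_mod_cast hn0
    have hK2 : ∀ ω, |(h n ω) ^ 2| ≤ (C * q n / n) ^ 2 := fun ω ↦ by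
      rw [abs_pow]
      exact pow_le_pow_left₀ (abs_nonneg _) (hsn ω) 2
    have hIh2 : Integrable (fun ω ↦ (h n ω) ^ 2) μ := integrable_of_abs_le (hmn.pow_const 2) hK2
    rw [← integral_add_compl (hGm n) hIh2]
    have hsplit : ∫ ω in G n, (h n ω) ^ 2 ∂μ = S n ^ 2 / (n : ℝ) ^ 2 * ∫ ω in G n, X ω ^ 2 ∂μ +
        ∫ ω in G n, ((h n ω) ^ 2 - S n ^ 2 * X ω ^ 2 / (n : ℝ) ^ 2) ∂μ := by
      have hI1 : Integrable (fun ω ↦ S n ^ 2 / (n : ℝ) ^ 2 * X ω ^ 2) μ := hIX2.const_mul _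
      have hI2 : Integrable (fun ω ↦ (h n ω) ^ 2 - S n ^ 2 * X ω ^ 2 / (n : ℝ) ^ 2) μ := by
        have : (fun ω ↦ (h n ω) ^ 2 - S n ^ 2 * X ω ^ 2 / (n : ℝ) ^ 2) =
            fun ω ↦ (h n ω) ^ 2 - S n ^ 2 / (n : ℝ) ^ 2 * X ω ^ 2 := by funext ω; ring
        rw [this]; exact hIh2.sub hI1
      rw [← integral_const_mul, ← integral_add hI1.integrableOn hI2.integrableOn]
      congr 1; funext ω; ring
    rw [hsplit]
    simp only [hV₁, hV₂, hV₃]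
    field_simp
  -- limits
  have hL₁ : Tendsto V₁ atTop (𝓝 (S₀ ^ 2 * ∫ ω, X ω ^ 2 ∂μ)) :=
    (hS.pow 2).mul (tendsto_setIntegral_good hBm monotone_scale_half tendsto_scale_half_atTop hIX2)
  have hL₃ : Tendsto V₃ atTop (𝓝 0) := by
    have h0 : Tendsto (fun n : ℕ ↦ 8 * C ^ 2 * EB3 * (q n)⁻¹) atTop (𝓝 0) := by
      have := tendsto_inv_scale.const_mul (8 * C ^ 2 * EB3)
      simpa using this
    refine squeeze_zero_norm' (a := fun n : ℕ ↦ 8 * C ^ 2 * EB3 * (q n)⁻¹) ?_ h0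
    filter_upwards [hsure, eventually_gt_atTop 0] with n hsn hn0
    have hnpos : (0 : ℝ) < n := by exact_mod_cast hn0
    have hqpos : 0 < q n := Real.rpow_pos_of_pos hnpos _
    rw [Real.norm_eq_abs, hV₃]
    simp only
    have h1 : ‖∫ ω in (G n)ᶜ, (h n ω) ^ 2 ∂μ‖ ≤ (C * q n / n) ^ 2 * μ.real (G n)ᶜ := by
      refine norm_setIntegral_le_of_norm_le_const (measure_lt_top _ _) fun ω _ ↦ ?_
      rw [Real.norm_eq_abs, abs_pow]
      exact pow_le_pow_left₀ (abs_nonneg _) (hsn ω) 2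
    have h2 : μ.real (G n)ᶜ ≤ EB3 / (q n / 2) ^ 3 := measureReal_compl_good_le hB3 hB0 (by positivity)
    rw [Real.norm_eq_abs] at h1
    calc |(n : ℝ) ^ 2 * ∫ ω in (G n)ᶜ, (h n ω) ^ 2 ∂μ|
        = (n : ℝ) ^ 2 * |∫ ω in (G n)ᶜ, (h n ω) ^ 2 ∂μ| := by rw [abs_mul, abs_of_pos (by positivity)]
      _ ≤ (n : ℝ) ^ 2 * ((C * q n / n) ^ 2 * (EB3 / (q n / 2) ^ 3)) := by
          apply mul_le_mul_of_nonneg_left _ (by positivity)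
          exact h1.trans (mul_le_mul_of_nonneg_left h2 (by positivity))
      _ = 8 * C ^ 2 * EB3 * (q n)⁻¹ := by field_simp; ring
  have hL₂ : Tendsto V₂ atTop (𝓝 0) := by
    -- deterministic majorant of `n² ∫_G |h² - S²X²/n²|`
    set a : ℕ → ℝ := fun n ↦ (n : ℝ) ^ 2 * |D n| * (|C| * (q n / n) + |S n| * EB / n) +
      3 * (|P n| + |C'|) * (|C| + |S n| / 2) * (EB3 + 1) * (q n / n) with ha
    have h0 : Tendsto a atTop (𝓝 0) := by
      have hD' : Tendsto (fun n : ℕ ↦ (n : ℝ) ^ 2 * |D n|) atTop (𝓝 |D₀|) := by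
        have := hD.abs
        refine this.congr' (Eventually.of_forall fun n ↦ ?_)
        rw [abs_mul, abs_of_nonneg (by positivity)]
      have h1 : Tendsto (fun n : ℕ ↦ |C| * (q n / n) + |S n| * EB / n) atTop (𝓝 0) := by
        have t1 := tendsto_scale_div.const_mul |C|
        have t2 : Tendsto (fun n : ℕ ↦ |S n| * EB / n) atTop (𝓝 0) := by
          have := (hS.abs.mul_const EB).mul tendsto_inv_natCast
          simpa [div_eq_mul_inv] using this
        simpa using t1.add t2
      have h2 : Tendsto (fun n : ℕ ↦ 3 * (|P n| + |C'|) * (|C| + |S n| / 2) * (EB3 + 1) * (q n / n))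
          atTop (𝓝 0) := by
        have hc : Tendsto (fun n : ℕ ↦ |C| + |S n| / 2) atTop (𝓝 (|C| + |S₀| / 2)) :=
          tendsto_const_nhds.add (hS.abs.div_const 2)
        have := ((((hP.abs.add_const |C'|).const_mul 3).mul hc).mul_const (EB3 + 1)).mul
          tendsto_scale_div
        simpa using this
      simpa [ha] using (hD'.mul h1).add h2
    refine squeeze_zero_norm' (a := a) ?_ h0
    have hqn : ∀ᶠ n : ℕ in atTop, q n ≤ n := by
      filter_upwards [eventually_ge_atTop 1] with n hn
      have hn1 : (1 : ℝ) ≤ n := by exact_mod_cast hn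
      have : q n ≤ (n : ℝ) ^ (1 : ℝ) := Real.rpow_le_rpow_of_exponent_le hn1 (by norm_num)
      simpa using this
    filter_upwards [hhm, hsure, hgood, hqn, eventually_gt_atTop 0] with n hmn hsn hgn hqn' hn0
    have hnpos : (0 : ℝ) < n := by exact_mod_cast hn0
    have hqpos : 0 < q n := Real.rpow_pos_of_pos hnpos _
    rw [Real.norm_eq_abs, hV₂]
    simp only
    -- the pointwise majorant on `G n`
    set Z : Ω → ℝ := fun ω ↦ |D n| * (|C| * q n + |S n| * B ω) / n +
      3 * (|P n| + |C'|) * (B ω ^ 3 + 1) * (|C| + |S n| / 2) * q n / (n : ℝ) ^ 3 with hZ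
    have hIZ : Integrable Z μ := by
      simp only [hZ]
      refine Integrable.add ?_ ?_
      · have : (fun ω ↦ |D n| * (|C| * q n + |S n| * B ω) / n) =
            fun ω ↦ |D n| * |C| * q n / n + |D n| * |S n| / n * B ω := by funext ω; ring
        rw [this]; exact (integrable_const _).add (hIB.const_mul _)
      · have : (fun ω ↦ 3 * (|P n| + |C'|) * (B ω ^ 3 + 1) * (|C| + |S n| / 2) * q n / (n : ℝ) ^ 3) =
            fun ω ↦ 3 * (|P n| + |C'|) * (|C| + |S n| / 2) * q n / (n : ℝ) ^ 3 * (B ω ^ 3 + 1) := by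
          funext ω; ring
        rw [this]; exact hIB31.const_mul _
    have hbound : ∀ᵐ ω ∂μ.restrict (G n), ‖(h n ω) ^ 2 - S n ^ 2 * X ω ^ 2 / (n : ℝ) ^ 2‖ ≤ Z ω := by
      rw [ae_restrict_iff' (hGm n)]
      filter_upwards [hgn, hXB] with ω hω hXω hωG
      have hBq : B ω ≤ q n / 2 := hωG
      have hB := hB0 ω
      rw [Real.norm_eq_abs]
      have hρ := hω hωG
      have key := abs_sq_sub_main_le (hω := h n ω) (Dn := D n) (Sn := S n) (Pn := P n) (Xω := X ω)
        (Bω := B ω) (R := |C'| * (B ω ^ 3 + B ω + 1) / (n : ℝ) ^ 3) (hb := |C| * q n / n) hnpos rfl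
        (hρ.trans (by
          rw [mul_div_assoc, mul_div_assoc]
          exact mul_le_mul_of_nonneg_right (le_abs_self _) (by positivity)))
        ((hsn ω).trans (by gcongr; exact le_abs_self C)) hXω hB
      refine key.trans ?_
      have hn1 : (1 : ℝ) ≤ n := by
        have : (1 : ℕ) ≤ n := hn0
        exact_mod_cast this
      have := majorant_le (D := D n) (P := P n) (C' := C') (C := C) (S := S n) hB hBq hqpos.le hn1
      simpa only [hZ] using this
    have h1 := norm_integral_le_of_norm_le hIZ.integrableOn hbound
    rw [Real.norm_eq_abs] at h1
    have h2 : ∫ ω in G n, Z ω ∂μ ≤ ∫ ω, Z ω ∂μ :=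
      setIntegral_le_integral hIZ (Eventually.of_forall fun ω ↦ by
        have := hB0 ω; simp only [hZ, Pi.zero_apply]; positivity)
    have h3 : ∫ ω, Z ω ∂μ = |D n| * (|C| * q n + |S n| * EB) / n +
        3 * (|P n| + |C'|) * (EB3 + 1) * (|C| + |S n| / 2) * q n / (n : ℝ) ^ 3 := by
      simp only [hZ]
      rw [integral_add]
      · have e1 : ∫ ω, |D n| * (|C| * q n + |S n| * B ω) / n ∂μ = |D n| * (|C| * q n + |S n| * EB) / n := by
          have : (fun ω ↦ |D n| * (|C| * q n + |S n| * B ω) / n) =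
              fun ω ↦ |D n| * |C| * q n / n + |D n| * |S n| / n * B ω := by funext ω; ring
          rw [this, integral_add (integrable_const _) (hIB.const_mul _), integral_const,
            integral_const_mul]
          simp only [smul_eq_mul, probReal_univ, one_mul]
          ring
        have e2 : ∫ ω, 3 * (|P n| + |C'|) * (B ω ^ 3 + 1) * (|C| + |S n| / 2) * q n / (n : ℝ) ^ 3 ∂μ =
            3 * (|P n| + |C'|) * (EB3 + 1) * (|C| + |S n| / 2) * q n / (n : ℝ) ^ 3 := by
          have : (fun ω ↦ 3 * (|P n| + |C'|) * (B ω ^ 3 + 1) * (|C| + |S n| / 2) * q n / (n : ℝ) ^ 3) =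
              fun ω ↦ 3 * (|P n| + |C'|) * (|C| + |S n| / 2) * q n / (n : ℝ) ^ 3 * (B ω ^ 3 + 1) := by
            funext ω; ring
          rw [this, integral_const_mul, integral_add hIB3 (integrable_const _), integral_const]
          simp only [smul_eq_mul, probReal_univ, one_mul]
          ring
        rw [e1, e2]
      · have : (fun ω ↦ |D n| * (|C| * q n + |S n| * B ω) / n) =
            fun ω ↦ |D n| * |C| * q n / n + |D n| * |S n| / n * B ω := by funext ω; ring
        rw [this]; exact (integrable_const _).add (hIB.const_mul _)
      · have : (fun ω ↦ 3 * (|P n| + |C'|) * (B ω ^ 3 + 1) * (|C| + |S n| / 2) * q n / (n : ℝ) ^ 3) =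
            fun ω ↦ 3 * (|P n| + |C'|) * (|C| + |S n| / 2) * q n / (n : ℝ) ^ 3 * (B ω ^ 3 + 1) := by
          funext ω; ring
        rw [this]; exact hIB31.const_mul _
    calc |(n : ℝ) ^ 2 * ∫ ω in G n, ((h n ω) ^ 2 - S n ^ 2 * X ω ^ 2 / (n : ℝ) ^ 2) ∂μ|
        = (n : ℝ) ^ 2 * |∫ ω in G n, ((h n ω) ^ 2 - S n ^ 2 * X ω ^ 2 / (n : ℝ) ^ 2) ∂μ| := by
          rw [abs_mul, abs_of_pos (by positivity)]
      _ ≤ (n : ℝ) ^ 2 * ∫ ω, Z ω ∂μ := mul_le_mul_of_nonneg_left (h1.trans h2) (by positivity)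
      _ = a n := by rw [h3]; simp only [ha]; field_simp
  have hsum : Tendsto (fun n ↦ V₁ n + V₂ n + V₃ n) atTop (𝓝 (S₀ ^ 2 * ∫ ω, X ω ^ 2 ∂μ + 0 + 0)) :=
    (hL₁.add hL₂).add hL₃
  simp only [add_zero] at hsum
  exact hsum.congr' (hdecomp.mono fun n hn ↦ hn.symm)

end Moments

/-- **Registered form** (glue sub-goal `farField_tendsto_second_moment` of stmt-CriticalPhenomena-0746):
second moment of the stopped-modulus increment, `n² E[(h n)²] → S₀² E[X²]`. [folklore] -/
theorem farField_tendsto_second_moment : ∀ {Ω : Type*} {mΩ : MeasurableSpace Ω} {μ : MeasureTheory.Measure Ω} [MeasureTheory.IsProbabilityMeasure μ] {X B : Ω → ℝ} {h : ℕ → Ω → ℝ} {S P D : ℕ → ℝ} {S₀ P₀ D₀ C C' : ℝ}, Measurable X → MeasureTheory.StronglyMeasurable B → MeasureTheory.MemLp B 3 μ → (∀ ω, 0 ≤ B ω) → (∀ᵐ ω ∂μ, |X ω| ≤ B ω) → (∀ᶠ n : ℕ in Filter.atTop, Measurable (h n)) → (∀ᶠ n : ℕ in Filter.atTop, ∀ ω,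 |h n ω| ≤ C * ((n : ℝ)) ^ (3 / 4 : ℝ) / n) → (∀ᶠ n : ℕ in Filter.atTop, ∀ᵐ ω ∂μ, B ω ≤ ((n : ℝ)) ^ (3 / 4 : ℝ) / 2 → |h n ω - D n + S n * (X ω / n) + P n * (X ω / n) ^ 2| ≤ C' * (B ω ^ 3 + B ω + 1) / (n : ℝ) ^ 3) → Filter.Tendsto S Filter.atTop (nhds S₀) → Filter.Tendsto P Filter.atTop (nhds P₀) → Filter.Tendsto (fun n : ℕ ↦ (n : ℝ) ^ 2 * D n) Filter.atTop (nhds D₀) → Filter.Tendsto (fun n : ℕ ↦ (n : ℝ) ^ 2 * ∫ ω, (h n ω) ^ 2 ∂μ) Filter.atTop (nhds (S₀ ^ 2 * ∫ ω, X ω ^ 2 ∂μ)) :=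
  fun hXm hBm hB3 hB0 hXB hhm hsure hgood hS hP hD ↦
    tendsto_second_moment hXm hBm hB3 hB0 hXB hhm hsure hgood hS hP hD

end FarField

end Summit.CriticalPhenomena.CardyFormulaZ2.Cruxes.CardyRigidity.CrossingMartingale

end
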